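import Summits.QuantumFields.BalabanUV.Beta.FP.KernelWardBoundedBricks

/-!
# `BalabanUV.Beta.FP.KernelWardBounded` — road «FP» for binder row D1, sub-row **H2-ASM-5a** (symmetry letters of `PiBF`), module W1 part 2∕2: THE WARD IDENTITY OF
# THE RESOLVENT HESSIAN FOR A **BOUNDED** LEG — `Literature…Beta.KernelWard.ward_hess` ∕ `wardTransversal_flip_hessKer` with `Decays A C δ` replaced by
# `KernelWard.Bdd A C` ([folklore]; nothing of the manuscripts)

HONEST DEPENDENCY (page 1, mandatory): continuum YM on T⁴ ⇐ BetaPertH ∧ nine spine estimates (0/9 proved); BetaPertH ⇐ (D1) ∧ (D4) ∧ CAP+tail;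
G-an2-4 gates asym, D1 and NE2/3/4.  HONEST FRAMING (cell contract, verbatim): «discharging `BetaPertH` makes Bałaban's UV stability UNCONDITIONAL —
a real constructive-QFT result; it is NOT the continuum limit and NOT the Clay problem.»  THIS MODULE DISCHARGES NOTHING of the wall: the one-line computation
`½·tr(A[X,V′]) − ½·tr([A,X]V′) = 0` made honest for a BOUNDED leg (part 1's right-localised bricks BY NAME); every analytic input — boundedness of the leg, localisation of
the vertex families, the generator `X`, the jet-level covariance laws (W1)∕(W2), block-translation covariance — is a HYPOTHESIS; 0 def, 0 `def … : Prop`, nothing cited,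
0 sorry; 0∕4 row-D1 binders; NOT the `PiBF` instance (module W2 `FP/PerfectPolarizationWard`), NOT (K0), NOT hgerm, NOT D1, NOT BetaPertH, NOT continuum, NOT Clay.

ABSOLUTE RULE (cell charter, verbatim): «No internally-minted statement may enter as a cited fact. Every hypothesis is either kernel-proved in this package or a
verbatim quotation of a PUBLISHED theorem with page reference. The manuscript(s) under audit are NOT citable for their own disputed steps — they are the thing
under adjudication; programme-internal (2001/route/tribunal) claims are never citable.»

CONTENT: **`ward_hess_bdd`** — `Bdd A C`, `VertexFamily V N Cv δ`, `VertexFamily₂ W N Cw δ`, generator `X y` bi-localised at `N•y`, (W1) `(A∘divV y)∘A = A∘X y − X y∘A`,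
(W2) `divW y ν y′ = X y∘V ν y′ − V ν y′∘X y` ⟹ `Σ_μ (hess μ (y−e_μ) ν y′ − hess μ y ν y′) = 0`; **`wardTransversal_flip_hessKer_bdd`** — + `BlockCovariant A V W N` ⟹
`WardTransversal (fun μ ν z => hessKer A V W μ ν (−z))`.  VERBATIM `KernelWard` §6 with `Decays ↦ Bdd` (the leg of `PiBF` is power-law: LOCATED READING L-gan24leaf02-g39-2,
owner AGREED l.26457).  Consumer: W2 (the `PiBF` instance at `N = 1` under (P-INV)∕(G-INV)∕(a4)∕(a8)).
Provenance: G-an2-4 formalisation swarm seat b2b-balaban-gan24-formalise-leaf-02 gen 39 (cross-lane on road FP; sub-row H2-ASM-5a WARD HALF, owner GO l.26457), 2026-08-21.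
-/

noncomputable section

namespace Summit.QuantumFields.BalabanUV.Beta.FP.KernelWardBounded

open Finset
open scoped BigOperators
open Literature.MathematicalPhysics.QuantumFieldTheory.Balaban1983to89
open Literature.MathematicalPhysics.QuantumFieldTheory.Balaban1983to89.Beta
open B12Sec2to5 (l1 l1_nonneg)
open B6BondElimination (unitVec unitVec_apply)
open PolarizationSign (WardTransversal)
open ExpKernelCalculus (MKer Decays BiLoc comp tr bubble tadpole VertexFamily VertexFamily₂ hess hessKer BlockCovariant Zl Zl_pos hess_eq_hessKer
  summable_exp_shift' tsum_exp_shift' biLoc_comp_biLoc l1_sub_triangle)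
open KernelWard (Bdd bdd_of_biLoc biLoc_recentre biLoc_sub biLoc_finset_sum slices_bdd_biLoc comp_sub_right comp_sub_left tr_sub
  comp_finset_sum_right comp_finset_sum_left tr_finset_sum comp_assoc_of_bound tr_comp_comm_of_bound divV divW)
open Summit.QuantumFields.BalabanUV.Beta.D1BFx.ContactCount (abs_comp_le_of_entryBound abs_comp_le_of_rightLoc)
open Summit.QuantumFields.BalabanUV.Beta.FP.KernelWardBoundedBricks

variable {D : ℕ} {F : Type*} [Fintype F]

/-! ## §4 The Ward identity of the resolvent Hessian, bounded leg -/

section Ward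

variable {A : MKer D F} {V : Fin D → (Fin D → ℤ) → MKer D F} {W : Fin D → (Fin D → ℤ) → Fin D → (Fin D → ℤ) → MKer D F}
  {C Cv Cw Cx δ : ℝ} {N : ℕ}

/-- [folklore] **THE WARD IDENTITY OF THE RESOLVENT HESSIAN, BOUNDED LEG** (`KernelWard.ward_hess` with `Decays A C δ ↦ Bdd A C`): `A` bounded, vertex families localised
at the coarse bonds, generator `X y` bi-localised at `N•y`, (W1) `(A∘divV y)∘A = A∘X y − X y∘A`, (W2) `divW y ν y′ = X y∘V ν y′ − V ν y′∘X y` ⟹ the Hessian is TRANSVERSAL in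
its first bond: `Σ_μ (hess μ (y − e_μ) ν y′ − hess μ y ν y′) = 0`.  The one-line computation `½·tr(A[X,V′]) − ½·tr([A,X]V′) = 0`; every trace is absolutely convergent
because both vertex kernels are bi-localised (right-localised calculus). -/
theorem ward_hess_bdd (X : (Fin D → ℤ) → MKer D F) (hA : Bdd A C) (hV : VertexFamily V N Cv δ) (hW : VertexFamily₂ W N Cw δ)
    (hX : ∀ y, BiLoc (X y) ((N : ℤ) • y) ((N : ℤ) • y) Cx δ) (hδ : 0 < δ)
    (hW1 : ∀ y, comp (comp A (divV V y)) A = comp A (X y) - comp (X y) A)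
    (hW2 : ∀ y ν y', divW W y ν y' = comp (X y) (V ν y') - comp (V ν y') (X y))
    (y : Fin D → ℤ) (ν : Fin D) (y' : Fin D → ℤ) :
    ∑ μ, (hess A V W μ (y - unitVec μ) ν y' - hess A V W μ y ν y') = 0 := by
  classical
  by_cases hF : Nonempty F
  swap
  · have hE : IsEmpty F := not_nonempty_iff.mp hF
    simp [ExpKernelCalculus.hess, ExpKernelCalculus.tadpole, ExpKernelCalculus.bubble, ExpKernelCalculus.tr]
  obtain ⟨a₀⟩ := hF
  have hC : 0 ≤ C := (abs_nonneg _).trans (hA 0 0 a₀ a₀)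
  -- localisations at the common points `N•y` (first bond) / `N•y′` (second bond), after recentring
  set P : Fin D → ℤ := (N : ℤ) • y with hPdef
  set Q : Fin D → ℤ := (N : ℤ) • y' with hQdef
  have hV₁ : ∀ μ ∈ (Finset.univ : Finset (Fin D)), BiLoc (V μ (y - unitVec μ)) P P
      (Cv * Real.exp (δ * (l1 ((N : ℤ) • (y - unitVec μ) - P) + l1 ((N : ℤ) • (y - unitVec μ) - P)))) δ :=
    fun μ _ => biLoc_recentre (hV μ (y - unitVec μ)) hδ.le P P
  have hV₂ : ∀ μ ∈ (Finset.univ : Finset (Fin D)), BiLoc (V μ y) P P (Cv * Real.exp (δ * (l1 (P - P) + l1 (P - P)))) δ :=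
    fun μ _ => biLoc_recentre (hV μ y) hδ.le P P
  have hW₁ : ∀ μ ∈ (Finset.univ : Finset (Fin D)), BiLoc (W μ (y - unitVec μ) ν y') P Q
      (Cw * Real.exp (δ * (l1 ((N : ℤ) • (y - unitVec μ) - P) + l1 (Q - Q)))) δ :=
    fun μ _ => biLoc_recentre (hW μ (y - unitVec μ) ν y') hδ.le P Q
  have hW₂ : ∀ μ ∈ (Finset.univ : Finset (Fin D)), BiLoc (W μ y ν y') P Q (Cw * Real.exp (δ * (l1 (P - P) + l1 (Q - Q)))) δ :=
    fun μ _ => biLoc_recentre (hW μ y ν y') hδ.le P Q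
  have hV' : BiLoc (V ν y') Q Q Cv δ := hV ν y'
  have hXy : BiLoc (X y) P P Cx δ := hX y
  -- step 1: the divergence of `hess` is `½ tadpole A (divW) − ½ bubble A (divV) V′`
  have e1 : ∑ μ, (hess A V W μ (y - unitVec μ) ν y' - hess A V W μ y ν y')
      = (1 / 2) * tadpole A (divW W y ν y') - (1 / 2) * bubble A (divV V y) (V ν y') := by
    unfold divW divV
    rw [tadpole_sum_sub_bdd Finset.univ hA hW₁ hW₂ hδ, bubble_sum_sub_left_bdd Finset.univ hA hV₁ hV₂ hV' hδ, Finset.mul_sum,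
      Finset.mul_sum, ← Finset.sum_sub_distrib]
    refine Finset.sum_congr rfl fun μ _ => ?_
    unfold ExpKernelCalculus.hess
    ring
  -- localisation of `divV`; the composed kernels are right-localised
  have hD : BiLoc (divV V y) P P _ δ := biLoc_finset_sum Finset.univ fun μ hμ => biLoc_sub (hV₁ μ hμ) (hV₂ μ hμ)
  have hAD := abs_comp_le_of_entryBound hC hA hD hδ
  have hAX := abs_comp_le_of_entryBound hC hA hXy hδ
  have hAV' := abs_comp_le_of_entryBound hC hA hV' hδ
  have hXV' := biLoc_comp_biLoc hXy hV' hδ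
  have hV'X := biLoc_comp_biLoc hV' hXy hδ
  have hδ2 : 0 < δ / 2 := by linarith
  -- step 2: the bubble term `tr((A∘divV)∘(A∘V′)) = tr(((A∘divV)∘A)∘V′) = tr((A∘X)∘V′) − tr(X∘(A∘V′))`
  have e2 : bubble A (divV V y) (V ν y') = tr (comp (comp A (X y)) (V ν y')) - tr (comp (X y) (comp A (V ν y'))) := by
    unfold ExpKernelCalculus.bubble
    rw [comp_assoc_rl_bdd_biLoc hAD hA hV' hδ, hW1 y]
    rw [comp_sub_left (slices_rl_bdd hAX (bdd_of_biLoc hV' hδ.le) hδ) ?_]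
    · rw [← comp_assoc_biLoc_bdd_biLoc hXy hA hV' hδ]
      exact tr_sub (summable_trTerm_rl (abs_comp_le_of_rightLoc hAX (rl_of_biLoc hV' hδ.le) hδ) hδ)
        (summable_trTerm_rl (abs_comp_le_of_rightLoc (rl_of_biLoc hXy hδ.le) hAV' hδ) hδ)
    · -- slices of `(X ∘ A) ∘ V′`: `X ∘ A` is bounded
      intro x z a b
      have hXA : Bdd (comp (X y) A) ((Fintype.card F : ℝ) * (Cx * C) * Zl D δ) := by
        intro u v c e
        have hc : 0 ≤ Cx := hXy.nonneg c
        show |∑' t, ∑ f, X y u t c f * A t v f e| ≤ _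
        have hs := summable_exp_shift' hδ P
        have hmaj := hs.mul_left ((Fintype.card F : ℝ) * (Cx * C))
        have hb := tsum_of_norm_bounded hmaj.hasSum (fun t => by
          rw [Real.norm_eq_abs]
          calc |∑ f, X y u t c f * A t v f e| ≤ ∑ f, |X y u t c f * A t v f e| := Finset.abs_sum_le_sum_abs _ _
            _ ≤ ∑ _f : F, Cx * C * Real.exp (-δ * l1 (t - P)) := Finset.sum_le_sum fun f _ => by
                rw [abs_mul]
                have h1 : |X y u t c f| ≤ Cx * Real.exp (-δ * l1 (t - P)) := by
                  refine (hXy u t c f).trans (mul_le_mul_of_nonneg_left (Real.exp_le_exp.mpr ?_) hc)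
                  nlinarith [l1_nonneg (u - P), hδ.le]
                have h2 : |A t v f e| ≤ C := hA t v f e
                calc |X y u t c f| * |A t v f e| ≤ (Cx * Real.exp (-δ * l1 (t - P))) * C :=
                      mul_le_mul h1 h2 (abs_nonneg _) (by positivity)
                  _ = Cx * C * Real.exp (-δ * l1 (t - P)) := by ring
            _ = (Fintype.card F : ℝ) * (Cx * C) * Real.exp (-δ * l1 (t - P)) := by
                rw [Finset.sum_const, Finset.card_univ, nsmul_eq_mul]; ring)
        rw [Real.norm_eq_abs] at hb
        refine hb.trans (le_of_eq ?_)
        rw [tsum_mul_left, tsum_exp_shift']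
      exact slices_bdd_biLoc hXA hV' hδ x z a b
  -- step 3: the tadpole term `tr(A∘(X∘V′ − V′∘X)) = tr((A∘X)∘V′) − tr(X∘(A∘V′))`
  have e3 : tadpole A (divW W y ν y') = tr (comp (comp A (X y)) (V ν y')) - tr (comp (X y) (comp A (V ν y'))) := by
    unfold ExpKernelCalculus.tadpole
    rw [hW2 y ν y', comp_sub_right (slices_bdd_biLoc hA hXV' hδ) (slices_bdd_biLoc hA hV'X hδ)]
    rw [tr_sub (summable_trTerm_rl (abs_comp_le_of_entryBound hC hA hXV' hδ) hδ)
      (summable_trTerm_rl (abs_comp_le_of_entryBound hC hA hV'X hδ) hδ)]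
    rw [comp_assoc_bdd_biLoc_biLoc hA hXy hV' hδ, comp_assoc_bdd_biLoc_biLoc hA hV' hXy hδ, tr_comp_comm_rl_biLoc hAV' hXy hδ]
  rw [e1, e2, e3]
  ring

/-- [folklore] **THE DIFFERENCE-VARIABLE FORM, BOUNDED LEG** (`KernelWard.wardTransversal_flip_hessKer` with `Decays ↦ Bdd`): under block-translation covariance the
Ward identity is the printed predicate `PolarizationSign.WardTransversal` of the FLIPPED kernel `z ↦ hessKer A V W μ ν (−z)`. -/
theorem wardTransversal_flip_hessKer_bdd (X : (Fin D → ℤ) → MKer D F) (hA : Bdd A C) (hV : VertexFamily V N Cv δ) (hW : VertexFamily₂ W N Cw δ)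
    (hX : ∀ y, BiLoc (X y) ((N : ℤ) • y) ((N : ℤ) • y) Cx δ) (hδ : 0 < δ) (hcov : BlockCovariant A V W N)
    (hW1 : ∀ y, comp (comp A (divV V y)) A = comp A (X y) - comp (X y) A)
    (hW2 : ∀ y ν y', divW W y ν y' = comp (X y) (V ν y') - comp (V ν y') (X y)) :
    WardTransversal (fun μ ν z => hessKer A V W μ ν (-z)) := by
  intro ν z
  have h := ward_hess_bdd X hA hV hW hX hδ hW1 hW2 0 ν (-z)
  have e : ∀ μ : Fin D, hess A V W μ (0 - unitVec μ) ν (-z) - hess A V W μ 0 ν (-z)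
      = hessKer A V W μ ν (-(z - unitVec μ)) - hessKer A V W μ ν (-z) := by
    intro μ
    rw [hess_eq_hessKer hcov, hess_eq_hessKer hcov]
    congr 2 <;> abel
  simpa only [e] using h

end Ward

end Summit.QuantumFields.BalabanUV.Beta.FP.KernelWardBounded

end
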